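import Summits.NavierStokesRegularity.FunctionalMining.NoGo.LogDoorStrain
import Literature.Geometry.DiscreteGeometry.LayerShells
import HarnessLib

/-!
# The log-door packet, II: the exact second variation and the packet palinstrophy

Search for candidate a priori estimates; no regularity claim. NS FUNCTIONAL MINING — NO-GO BRANCH
(cell `pub-nsfunc`, prove seat gen 3). Continuation of `NoGo/LogDoorPacket.lean` (`W = packet φ`,
`E = strain n η`, profiles `φ = (a, g, η)` smooth and vanishing off `[-2, 2]`).

* `qint n φ` — the second-variation integrand `⟪DW(W), Δ²E⟫ + ⟪DE(W), Δ²W⟫ + ⟪DW(E), Δ²W⟫`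
  (the `W`-quadratic part of `∫⟪Dv(v), Δ²v⟫` at `v = E ± W`);
* `qint_eq` — its expansion into the 38 separable monomials of `tableQ` (checked by `ring`);
* `integral_qint` — **the identity**
  `∫ qint n φ = n · J(η;0,0,0) · (Sq a 3 Sq g 0 + Sq a 2 Sq g 1 − Sq a 1 Sq g 2 − Sq a 0 Sq g 3)`
  (Fubini row by row, then the pair-integral reductions `Jw_…` of `NoGo/PairIntegrals.lean`; every
  `η`-derivative term cancels);
* `norm_sq_laplacian_packet_eq`, `integral_norm_sq_laplacian_packet` — the packet palinstrophy
  `∫‖ΔW‖² = Sq η 0 (Sq a 0 Sq g 3 + 3 Sq a 1 Sq g 2 + 3 Sq a 2 Sq g 1 + Sq a 3 Sq g 0)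
            + 2 Sq η 1 (Sq a 0 Sq g 2 + 2 Sq a 1 Sq g 1 + Sq a 2 Sq g 0) + Sq η 2 (Sq a 0 Sq g 1 + Sq a 1 Sq g 0)`
  (12 monomials, `tableP`).
The tables were generated by a small polynomial CAS (cell folder `work/sym/logdoor.py`) and are
re-verified here symbolically. Folklore calculus; nothing is asserted about Navier–Stokes.
-/

open MeasureTheory Set Function
open scoped ContDiff Laplacian InnerProductSpace RealInnerProductSpace

namespace Summit.NavierStokesRegularity.FunctionalMining

namespace Sep3

/-- `Jw f l l 0 = Sq f l`. [folklore] -/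
theorem Jw_self (f : ℝ → ℝ) (l : ℕ) : Jw f l l 0 = Sq f l := (Sq_eq_Jw f l).symm

/-! ## Rows of separable monomials (quadratic in the packet profiles) -/

/-- A row `c · ∫tᵐa⁽ⁱ¹⁾a⁽ⁱ²⁾ · ∫tᵐ'g⁽ʲ¹⁾g⁽ʲ²⁾ · ∫η⁽ᵏ¹⁾η⁽ᵏ²⁾η⁽ᵏ³⁾`: coefficient, `(i₁, i₂, m)`,
`(j₁, j₂, m')`, `(k₁, k₂, k₃)`. [folklore] -/
structure RowQ where
  /-- integer coefficient -/
  c : ℤ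
  /-- `x`-profile: derivative orders and weight exponent `(i₁, i₂, m)` -/
  x : ℕ × ℕ × ℕ
  /-- `y`-profile: derivative orders and weight exponent `(j₁, j₂, m')` -/
  y : ℕ × ℕ × ℕ
  /-- `z`-profile: three derivative orders -/
  z : Idx

/-- A row `c · ∫a⁽ⁱ¹⁾a⁽ⁱ²⁾ · ∫g⁽ʲ¹⁾g⁽ʲ²⁾ · ∫η⁽ᵏ¹⁾η⁽ᵏ²⁾`. [folklore] -/
structure RowP where
  /-- integer coefficient -/
  c : ℤ
  /-- `x`-profile derivative orders -/
  x : ℕ × ℕ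
  /-- `y`-profile derivative orders -/
  y : ℕ × ℕ
  /-- `z`-profile derivative orders -/
  z : ℕ × ℕ

variable (φ : Fin 3 → ℝ → ℝ)

/-- Pointwise value of a `RowQ` monomial. [folklore] -/
noncomputable def RowQ.fn (r : RowQ) : E3 → ℝ := fun v =>
  pw (φ 0) r.x.1 r.x.2.1 r.x.2.2 (v 0) * pw (φ 1) r.y.1 r.y.2.1 r.y.2.2 (v 1) * tri (φ 2) r.z (v 2)

/-- Integral of a `RowQ` monomial: a product of three one-dimensional integrals. [folklore] -/
noncomputable def RowQ.val (r : RowQ) : ℝ :=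
  Jw (φ 0) r.x.1 r.x.2.1 r.x.2.2 * Jw (φ 1) r.y.1 r.y.2.1 r.y.2.2 * J (φ 2) r.z

/-- Pointwise value of a `RowP` monomial. [folklore] -/
noncomputable def RowP.fn (r : RowP) : E3 → ℝ := fun v =>
  pw (φ 0) r.x.1 r.x.2 0 (v 0) * pw (φ 1) r.y.1 r.y.2 0 (v 1) * pw (φ 2) r.z.1 r.z.2 0 (v 2)

/-- Integral of a `RowP` monomial. [folklore] -/
noncomputable def RowP.val (r : RowP) : ℝ :=
  Jw (φ 0) r.x.1 r.x.2 0 * Jw (φ 1) r.y.1 r.y.2 0 * Jw (φ 2) r.z.1 r.z.2 0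

/-- Fubini for a `RowQ` monomial. [folklore] -/
theorem RowQ.integral_fn (r : RowQ) : ∫ v, r.fn φ v = r.val φ := by
  unfold RowQ.fn RowQ.val Jw J
  exact integral_sep3 _ _ _

/-- Fubini for a `RowP` monomial. [folklore] -/
theorem RowP.integral_fn (r : RowP) : ∫ v, r.fn φ v = r.val φ := by
  unfold RowP.fn RowP.val Jw
  exact integral_sep3 _ _ _

variable {φ}

/-- Continuity of a `RowQ` monomial. [folklore] -/
theorem RowQ.continuous_fn (hφ : ∀ a, ContDiff ℝ ∞ (φ a)) (r : RowQ) : Continuous (r.fn φ) :=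
  (((continuous_pw (hφ 0) _ _ _).comp (EuclideanSpace.proj (0 : Fin 3) : E3 →L[ℝ] ℝ).continuous).mul
    ((continuous_pw (hφ 1) _ _ _).comp (EuclideanSpace.proj (1 : Fin 3) : E3 →L[ℝ] ℝ).continuous)).mul
    ((continuous_tri (hφ 2) r.z).comp (EuclideanSpace.proj (2 : Fin 3) : E3 →L[ℝ] ℝ).continuous)

/-- Continuity of a `RowP` monomial. [folklore] -/
theorem RowP.continuous_fn (hφ : ∀ a, ContDiff ℝ ∞ (φ a)) (r : RowP) : Continuous (r.fn φ) :=
  (((continuous_pw (hφ 0) _ _ _).comp (EuclideanSpace.proj (0 : Fin 3) : E3 →L[ℝ] ℝ).continuous).mul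
    ((continuous_pw (hφ 1) _ _ _).comp (EuclideanSpace.proj (1 : Fin 3) : E3 →L[ℝ] ℝ).continuous)).mul
    ((continuous_pw (hφ 2) _ _ _).comp (EuclideanSpace.proj (2 : Fin 3) : E3 →L[ℝ] ℝ).continuous)

/-- A `RowQ` monomial vanishes where a coordinate exceeds `2` in modulus. [folklore] -/
theorem RowQ.fn_eq_zero (h0 : ∀ a t, 2 < |t| → φ a t = 0) (r : RowQ) {v : E3} {a : Fin 3}
    (ha : 2 < |v a|) : r.fn φ v = 0 := by
  unfold RowQ.fn
  obtain rfl | rfl | rfl : a = 0 ∨ a = 1 ∨ a = 2 := by fin_cases a <;> simp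
  · rw [pw_eq_zero (h0 0) _ _ _ ha]; ring
  · rw [pw_eq_zero (h0 1) _ _ _ ha]; ring
  · rw [tri_eq_zero (h0 2) _ ha]; ring

/-- A `RowP` monomial vanishes where a coordinate exceeds `2` in modulus. [folklore] -/
theorem RowP.fn_eq_zero (h0 : ∀ a t, 2 < |t| → φ a t = 0) (r : RowP) {v : E3} {a : Fin 3}
    (ha : 2 < |v a|) : r.fn φ v = 0 := by
  unfold RowP.fn
  obtain rfl | rfl | rfl : a = 0 ∨ a = 1 ∨ a = 2 := by fin_cases a <;> simp
  · rw [pw_eq_zero (h0 0) _ _ _ ha]; ring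
  · rw [pw_eq_zero (h0 1) _ _ _ ha]; ring
  · rw [pw_eq_zero (h0 2) _ _ _ ha]; ring

/-- Integrability of a `RowQ` monomial. [folklore] -/
theorem RowQ.integrable_fn (hφ : ∀ a, ContDiff ℝ ∞ (φ a)) (h0 : ∀ a t, 2 < |t| → φ a t = 0)
    (r : RowQ) : Integrable (r.fn φ) := by
  refine (r.continuous_fn hφ).integrable_of_hasCompactSupport
    (HasCompactSupport.intro (isCompact_closedBall (0 : E3) 4) fun v hv => ?_)
  rw [Metric.mem_closedBall, dist_zero_right, not_le] at hv
  obtain ⟨a, ha⟩ := exists_two_lt_abs_coord hv.le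
  exact r.fn_eq_zero h0 ha

/-- Integrability of a `RowP` monomial. [folklore] -/
theorem RowP.integrable_fn (hφ : ∀ a, ContDiff ℝ ∞ (φ a)) (h0 : ∀ a t, 2 < |t| → φ a t = 0)
    (r : RowP) : Integrable (r.fn φ) := by
  refine (r.continuous_fn hφ).integrable_of_hasCompactSupport
    (HasCompactSupport.intro (isCompact_closedBall (0 : E3) 4) fun v hv => ?_)
  rw [Metric.mem_closedBall, dist_zero_right, not_le] at hv
  obtain ⟨a, ha⟩ := exists_two_lt_abs_coord hv.le
  exact r.fn_eq_zero h0 ha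

/-! ## The tables -/

/-- The 38 separable monomials of the second variation `qint` (coefficient; `(i₁,i₂,m)` on `a`;
`(j₁,j₂,m')` on `g`; `(k₁,k₂,k₃)` on `η`). [folklore] -/
def tableQ : List RowQ := [
  ⟨1, (0, 0, 0), (1, 1, 0), (0, 0, 4)⟩,
  ⟨2, (0, 0, 0), (1, 3, 0), (0, 0, 2)⟩,
  ⟨1, (0, 0, 0), (1, 5, 0), (0, 0, 0)⟩,
  ⟨-1, (0, 0, 0), (1, 2, 1), (0, 0, 4)⟩,
  ⟨-2, (0, 0, 0), (2, 3, 1), (0, 0, 2)⟩,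
  ⟨-1, (0, 0, 0), (2, 5, 1), (0, 0, 0)⟩,
  ⟨2, (0, 2, 0), (1, 1, 0), (0, 0, 2)⟩,
  ⟨2, (0, 2, 0), (1, 3, 0), (0, 0, 0)⟩,
  ⟨1, (0, 2, 0), (0, 1, 1), (0, 0, 4)⟩,
  ⟨-2, (0, 2, 0), (1, 2, 1), (0, 0, 2)⟩,
  ⟨-2, (0, 2, 0), (2, 3, 1), (0, 0, 0)⟩,
  ⟨1, (0, 4, 0), (1, 1, 0), (0, 0, 0)⟩,
  ⟨-1, (0, 4, 0), (1, 2, 1), (0, 0, 0)⟩,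
  ⟨-1, (1, 1, 0), (0, 0, 0), (0, 0, 4)⟩,
  ⟨-2, (1, 1, 0), (0, 2, 0), (0, 0, 2)⟩,
  ⟨-1, (1, 1, 0), (0, 4, 0), (0, 0, 0)⟩,
  ⟨-2, (1, 1, 0), (0, 1, 1), (0, 0, 4)⟩,
  ⟨-2, (1, 1, 0), (1, 2, 1), (0, 0, 2)⟩,
  ⟨-1, (1, 1, 0), (1, 4, 1), (0, 0, 0)⟩,
  ⟨-2, (1, 3, 0), (0, 0, 0), (0, 0, 2)⟩,
  ⟨-2, (1, 3, 0), (0, 2, 0), (0, 0, 0)⟩,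
  ⟨-2, (1, 3, 0), (0, 1, 1), (0, 0, 2)⟩,
  ⟨-2, (1, 3, 0), (1, 2, 1), (0, 0, 0)⟩,
  ⟨-1, (1, 5, 0), (0, 0, 0), (0, 0, 0)⟩,
  ⟨-1, (1, 5, 0), (0, 1, 1), (0, 0, 0)⟩,
  ⟨-1, (0, 1, 1), (0, 2, 0), (0, 0, 4)⟩,
  ⟨2, (0, 1, 1), (1, 1, 0), (0, 0, 4)⟩,
  ⟨2, (0, 1, 1), (1, 3, 0), (0, 0, 2)⟩,
  ⟨1, (0, 1, 1), (1, 5, 0), (0, 0, 0)⟩,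
  ⟨1, (1, 2, 1), (0, 0, 0), (0, 0, 4)⟩,
  ⟨2, (1, 2, 1), (0, 2, 0), (0, 0, 2)⟩,
  ⟨1, (1, 2, 1), (0, 4, 0), (0, 0, 0)⟩,
  ⟨2, (1, 2, 1), (1, 1, 0), (0, 0, 2)⟩,
  ⟨2, (1, 2, 1), (1, 3, 0), (0, 0, 0)⟩,
  ⟨1, (1, 4, 1), (1, 1, 0), (0, 0, 0)⟩,
  ⟨2, (2, 3, 1), (0, 0, 0), (0, 0, 2)⟩,
  ⟨2, (2, 3, 1), (0, 2, 0), (0, 0, 0)⟩,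
  ⟨1, (2, 5, 1), (0, 0, 0), (0, 0, 0)⟩]

/-- The 12 separable monomials of `‖ΔW‖²`. [folklore] -/
def tableP : List RowP := [
  ⟨1, (0, 0), (1, 1), (2, 2)⟩,
  ⟨2, (0, 0), (1, 3), (0, 2)⟩,
  ⟨1, (0, 0), (3, 3), (0, 0)⟩,
  ⟨2, (0, 2), (1, 1), (0, 2)⟩,
  ⟨2, (0, 2), (1, 3), (0, 0)⟩,
  ⟨1, (1, 1), (0, 0), (2, 2)⟩,
  ⟨2, (1, 1), (0, 2), (0, 2)⟩,
  ⟨1, (1, 1), (2, 2), (0, 0)⟩,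
  ⟨2, (1, 3), (0, 0), (0, 2)⟩,
  ⟨2, (1, 3), (0, 2), (0, 0)⟩,
  ⟨1, (2, 2), (1, 1), (0, 0)⟩,
  ⟨1, (3, 3), (0, 0), (0, 0)⟩]

/-! ## The second variation integrand and its expansion -/

/-- The second-variation integrand `⟪DW(W), Δ²E⟫ + ⟪DE(W), Δ²W⟫ + ⟪DW(E), Δ²W⟫` at `y`
(`W = packet ψ`, `E = strain n (ψ 2)`, `⟪Dv(w), u⟫ = Σₖ (Σⱼ wⱼ ∂ⱼvₖ) uₖ`). [folklore] -/
noncomputable def qint (ψ : Fin 3 → ℝ → ℝ) (n : ℝ) (y : E3) : ℝ :=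
  ⟪fderiv ℝ (packet ψ) y (packet ψ y), Δ (Δ (strain n (ψ 2))) y⟫ +
    ⟪fderiv ℝ (strain n (ψ 2)) y (packet ψ y), Δ (Δ (packet ψ)) y⟫ +
    ⟪fderiv ℝ (packet ψ) y (strain n (ψ 2) y), Δ (Δ (packet ψ)) y⟫

/-- **Pointwise expansion of the second variation into the 38 monomials of `tableQ`.**
[folklore] -/
theorem qint_eq (hφ : ∀ a, ContDiff ℝ ∞ (φ a)) (n : ℝ) (y : E3) :
    qint φ n y = n * (tableQ.map fun r => (r.c : ℝ) * r.fn φ y).sum := by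
  rw [qint, Literature.Geometry.DiscreteGeometry.inner_fin3,
    Literature.Geometry.DiscreteGeometry.inner_fin3, Literature.Geometry.DiscreteGeometry.inner_fin3]
  simp only [fderiv_packet_apply hφ, fderiv_strain_apply (n := n) (hφ 2), packet_apply,
    strain_apply', laplacian2_packet_apply hφ, laplacian2_strain_apply (n := n) (hφ 2),
    UW_zero_apply, UW_one_apply, UW_two_apply, UE_zero_apply, UE_one_apply, UE_two_apply,
    fderiv_UW_zero hφ, fderiv_UW_one hφ, fderiv_UW_two, fderiv_UE_zero (n := n) (hφ 2),
    fderiv_UE_one (n := n) (hφ 2), fderiv_UE_two, laplacian2_UW_zero hφ, laplacian2_UW_one hφ,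
    laplacian2_UW_two, laplacian2_UE_zero (n := n) (hφ 2), laplacian2_UE_one (n := n) (hφ 2),
    laplacian2_UE_two]
  simp only [sep, tableQ, List.map_cons, List.map_nil, List.sum_cons, List.sum_nil, RowQ.fn, pw,
    tri, iteratedDeriv_zero, pow_zero, pow_one, one_mul, Int.cast_one, Int.cast_neg, Int.cast_ofNat]
  ring

/-- **Pointwise expansion of `‖ΔW‖²` into the 12 monomials of `tableP`.** [folklore] -/
theorem norm_sq_laplacian_packet_eq (hφ : ∀ a, ContDiff ℝ ∞ (φ a)) (y : E3) :
    ‖Δ (packet φ) y‖ ^ 2 = (tableP.map fun r => (r.c : ℝ) * r.fn φ y).sum := by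
  rw [EuclideanSpace.norm_sq_eq, Fin.sum_univ_three]
  simp only [Real.norm_eq_abs, sq_abs, laplacian_packet_apply hφ, laplacian_UW_zero hφ,
    laplacian_UW_one hφ, laplacian_UW_two, sep, tableP, List.map_cons, List.map_nil, List.sum_cons,
    List.sum_nil, RowP.fn, pw, iteratedDeriv_zero, pow_zero, one_mul, Int.cast_one, Int.cast_ofNat]
  ring

/-! ## The identities -/

/-- **THE SECOND VARIATION OF THE BI-LAPLACIAN PRODUCTION AT A LINEAR STRAIN ALONG A SHEAR PACKET.**
For smooth profiles `a, g, η` vanishing off `[-2,2]` and every rate `n`: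
`∫ (⟪DW(W), Δ²E⟫ + ⟪DE(W), Δ²W⟫ + ⟪DW(E), Δ²W⟫)
   = n · (∫η³) · (Sq a 3 · Sq g 0 + Sq a 2 · Sq g 1 − Sq a 1 · Sq g 2 − Sq a 0 · Sq g 3)`,
`Sq f l = ∫(f⁽ˡ⁾)²`. All `η'`-, `η''`-, `η⁽⁴⁾`-terms cancel after the one-dimensional integrations by
parts. With a high-frequency `y`-profile `g` the term `−n (∫η³) Sq a 0 · Sq g 3` dominates: the
packet's vorticity gradient is compressed at the strain rate `n`. [folklore] -/
theorem integral_qint (hφ : ∀ a, ContDiff ℝ ∞ (φ a)) (h0 : ∀ a t, 2 < |t| → φ a t = 0) (n : ℝ) :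
    ∫ y, qint φ n y =
      n * J (φ 2) (0, 0, 0) *
        (Sq (φ 0) 3 * Sq (φ 1) 0 + Sq (φ 0) 2 * Sq (φ 1) 1 - Sq (φ 0) 1 * Sq (φ 1) 2 -
          Sq (φ 0) 0 * Sq (φ 1) 3) := by
  have hrow : ∀ r ∈ tableQ, Integrable (r.fn φ) := fun r _ => r.integrable_fn hφ h0
  simp_rw [qint_eq hφ]
  rw [integral_const_mul, integral_listSum (fun r : RowQ => (r.c : ℝ)) (fun r => r.fn φ) tableQ hrow]
  simp only [RowQ.integral_fn]
  have ha := hφ 0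
  have hg := hφ 1
  have h0a := h0 0
  have h0g := h0 1
  simp only [tableQ, List.map_cons, List.map_nil, List.sum_cons, List.sum_nil, RowQ.val, Jw_self,
    Jw_011 ha h0a, Jw_020 ha h0a, Jw_040 ha h0a, Jw_121 ha h0a, Jw_130 ha h0a, Jw_141 ha h0a,
    Jw_150 ha h0a, Jw_231 ha h0a, Jw_251 ha h0a,
    Jw_011 hg h0g, Jw_020 hg h0g, Jw_040 hg h0g, Jw_121 hg h0g, Jw_130 hg h0g, Jw_141 hg h0g,
    Jw_150 hg h0g, Jw_231 hg h0g, Jw_251 hg h0g, Int.cast_one, Int.cast_neg, Int.cast_ofNat]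
  ring

/-- **The packet palinstrophy.** For smooth profiles vanishing off `[-2,2]`:
`∫‖ΔW‖² = Sq η 0 (Sq a 0 Sq g 3 + 3 Sq a 1 Sq g 2 + 3 Sq a 2 Sq g 1 + Sq a 3 Sq g 0)
         + 2 Sq η 1 (Sq a 0 Sq g 2 + 2 Sq a 1 Sq g 1 + Sq a 2 Sq g 0) + Sq η 2 (Sq a 0 Sq g 1 + Sq a 1 Sq g 0)`.
[folklore] -/
theorem integral_norm_sq_laplacian_packet (hφ : ∀ a, ContDiff ℝ ∞ (φ a))
    (h0 : ∀ a t, 2 < |t| → φ a t = 0) :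
    ∫ y, ‖Δ (packet φ) y‖ ^ 2 =
      Sq (φ 2) 0 * (Sq (φ 0) 0 * Sq (φ 1) 3 + 3 * (Sq (φ 0) 1 * Sq (φ 1) 2) +
          3 * (Sq (φ 0) 2 * Sq (φ 1) 1) + Sq (φ 0) 3 * Sq (φ 1) 0) +
        2 * Sq (φ 2) 1 * (Sq (φ 0) 0 * Sq (φ 1) 2 + 2 * (Sq (φ 0) 1 * Sq (φ 1) 1) +
          Sq (φ 0) 2 * Sq (φ 1) 0) +
        Sq (φ 2) 2 * (Sq (φ 0) 0 * Sq (φ 1) 1 + Sq (φ 0) 1 * Sq (φ 1) 0) := by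
  have hrow : ∀ r ∈ tableP, Integrable (r.fn φ) := fun r _ => r.integrable_fn hφ h0
  simp_rw [norm_sq_laplacian_packet_eq hφ]
  rw [integral_listSum (fun r : RowP => (r.c : ℝ)) (fun r => r.fn φ) tableP hrow]
  simp only [RowP.integral_fn]
  have ha := hφ 0
  have hg := hφ 1
  have he := hφ 2
  have h0a := h0 0
  have h0g := h0 1
  have h0e := h0 2
  simp only [tableP, List.map_cons, List.map_nil, List.sum_cons, List.sum_nil, RowP.val, Jw_self,
    Jw_020 ha h0a, Jw_130 ha h0a, Jw_020 hg h0g, Jw_130 hg h0g, Jw_020 he h0e,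
    Int.cast_one, Int.cast_ofNat]
  ring

end Sep3

end Summit.NavierStokesRegularity.FunctionalMining
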